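import Literature.AlgebraicGeometry.Resolution.DiffStableAdjoin
import Mathlib.RingTheory.Algebraic.MvPolynomial
import Mathlib.RingTheory.AlgebraicIndependent.Transcendental
import Mathlib.Algebra.MvPolynomial.NoZeroDivisors
import HarnessLib

/-!
# Graded, differentially stable subalgebras of a polynomial ring over an ARBITRARY field:
# Hironaka's triangular additive basis (Hironaka 1970; Giraud 1975, §1.6 (3))

Topic: `Literature/AlgebraicGeometry/Resolution`. Let `K` be ANY field of exponential
characteristic `p` (`p = 1` in characteristic `0`; `K` need NOT be perfect) and
`U ⊆ K[x_i : i ∈ σ]` a graded `K`-subalgebra stable under all Hasse–Schmidt derivations `D^{(β)}`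
(`IsGradedSubalgebra U`, `IsDiffStable U` of `HasseSchmidtCoefficients.lean`). This file proves
the structure theorem that `DiffStableSubalgebra.lean` (perfect `K`: `U = K[ℓ_1^{p^{e_1}}, …]`,
powers of LINEAR forms) lists under "Deliberately NOT here: the non-perfect case (Hironaka's
general triangular form `σ_i = Σ_j c_{ij} x_j^{q_i}` with `c_{ij} ∈ K` …)".

> **Giraud 1975, p. 204, before (3) of §1.6** (`U` = the algebra of invariants of the ridge,
> generated by additive homogeneous polynomials): "on considère des polynômes additifs `σ_i` qui
> engendrent `U` et à la suite de Hironaka [8], on note que, quitte à changer l'ordre des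
> variables `X_j`, on peut modifier les `σ_i` de manière à avoir un système triangulaire
> (3) `σ_i = X_i^{q(i)} + Σ_{j>i} c_{ij} X_j^{q(i)}`, `1 ≤ i ≤ e`,
> avec `q(1) ≤ q(2) … ≤ q(e)`, où les `q(i)` sont des puissances de l'exposant caractéristique
> du corps de base."  And p. 205 (proof of Lemme 1.7): "Comme les `σ_i` sont algébriquement
> indépendants et que les `F_i` appartiennent à `U = k[σ]` d'après 1.6 …".
> ([8] = Hironaka, *Additive groups associated with points of a projective space*, 1970.)

## Main statements (everything proved, no named facts)

* **`exists_eq_adjoin_triangular_of_isDiffStable`** (Hironaka–Giraud triangular basis over any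
  field): there are `r ≤ #σ` distinct PIVOT variables `x_{ι(1)}, …, x_{ι(r)}` (`ι` injective),
  exponents `e_1 ≤ … ≤ e_r` and a coefficient matrix `c : Fin r → σ → K` in ECHELON form with
  respect to the pivots — `c_{j, ι(j)} = 1`, `c_{j, ι(j')} = 0` for `j' < j` — such that the
  additive forms `σ_j = Σ_k c_{jk} x_k^{p^{e_j}} = x_{ι(j)}^{p^{e_j}} + Σ_{k ∉ {ι(1),…,ι(j)}} c_{jk} x_k^{p^{e_j}}`
  are ALGEBRAICALLY INDEPENDENT over `K` and `U = K[σ_1, …, σ_r]` (`Algebra.adjoin`); after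
  renaming the variables so that `ι(j) = j` this is literally Giraud's (3).
  `exists_eq_adjoin_triangular_of_isDiffStable_fin` is the `K[x_1, …, x_n]` form (`r ≤ n`).
* **`isGradedSubalgebra_and_isDiffStable_iff_triangular`**: conversely every `K[σ_1, …, σ_r]`
  with `σ_j = Σ_k c_{jk} x_k^{p^{e_j}}` (any coefficients) is graded and Hasse–Schmidt stable
  (`isDiffStable_adjoin_sum_C_mul_X_pow`), so the theorem is a characterisation.
* **`finrank_adjoin_inf_homogeneousSubmodule_of_isHomogeneous`**: for algebraically independent
  HOMOGENEOUS generators `g_j` of degrees `q_j`, `dim_K K[g]_a = #{m ∈ ℕ^r : Σ_j m_j q_j = a}`;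
  hence (`finrank_inf_homogeneousSubmodule_eq_natCard_of_isDiffStable`) the Hilbert function of
  `U` is that of a polynomial ring with generators in degrees `p^{e_1} ≤ … ≤ p^{e_r}` — the
  numerical datum `(r; p^{e_1}, …, p^{e_r})` is therefore defined over ANY field (its
  independence of the presentation is `Hironaka2017/EdgeAlgebraHilbert.exists_cast_eq_of_hilb_eq`).
* The induction `exists_adjoin_triangular_eq_aux` (on the finite set `S` of admissible
  variables, `U ⊆ K[x_k : k ∈ S]`), which differs from the perfect-field induction of
  `DiffStableSubalgebra.lean` at exactly one point: the form of least positive degree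
  `g₀ = Σ_k a_k x_k^{p^e} ∈ U` (key lemmas 1–2 there, valid over any field) is in general NOT a
  `p^e`-th power of a linear form, and no linear change of variables moves it to `x_{i₀}^{p^e}`
  (`DiffStableCounterexamples.ratFunc_counterexample`: `U = K[x^p + t y^p]`, `K = 𝔽_p(t)`);
  instead one normalises `g₀` to `s₀ = x_{i₀}^{p^e} + τ` with `τ` free of `x_{i₀}`
  (`a_{i₀} ≠ 0`) and peels off `x_{i₀}` along `s₀` rather than along `x_{i₀}^{p^e}`:
  - `le_adjoin_insert_X_pow_add_of_minDeg` — `U ⊆ K[s₀][U ∩ K[x_k : k ≠ i₀]]`: the top `x_{i₀}`-layer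
    `g = D^{(t e_{i₀})} f ∈ U` of `f ∈ U` (`t = deg_{x_{i₀}} f = p^e c`, key lemma 3 there) is
    removed by subtracting `s₀^c g`, because `deg_{x_{i₀}} (s₀^c − x_{i₀}^{p^e c}) < p^e c`
    (`degreeOf_pow_sub_X_pow_lt`);
  - `transcendental_X_pow_add_of_le_supported` — `x_{i₀}^q + τ` (`τ ∈ K[x_k : k ≠ i₀]`) is
    transcendental over every subalgebra of `K[x_k : k ≠ i₀]` (Mathlib's
    `transcendental_supported_X` and `Transcendental.aeval_of_transcendental`), which feeds
    `AlgebraicIndependent.option_iff` up the induction (Giraud's "les `σ_i` sont algébriquement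
    indépendants", p. 205).

Proof route: ours (elementary coefficient calculus); Hironaka 1970 and Oda 1983 argue with the
group scheme `Spec K[x]/U_+K[x]` and its Dieudonné/Hopf structure, Giraud cites Hironaka. The
statement proved is Giraud's (3) verbatim (with the algebraic independence he uses on p. 205).

## Relation to the review of Hironaka's 2017 manuscript (`Hironaka2017/*`)

The manuscript fixes a PERFECT base field (p. 4, l. 23: "we may choose `K = ℤ/pℤ`") and reads
its edge data only at closed points (`Sing(E)_cl`), where residue fields are perfect and
`DiffStableSubalgebra.lean` applies; its Remark 4.13 (p. 22) defers "hard questions … with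
imperfect residue fields". This file makes precise what survives at a non-closed point `ξ`
(residue field `κ(ξ)` imperfect): the edge algebra is still a polynomial ring on `r ≤ n`
additive triangular generators of `p`-power degrees `q_1 ≤ … ≤ q_r`, and its Hilbert function —
hence the numerical invariant `(r; q)` entering `Inv_ξ` ((34), p. 24) — is defined exactly as at
closed points; what fails is only the presentation (25), p. 21, `f_j = z_j^{q_j}` by powers of
LINEAR forms (`DiffStableCounterexamples.not_exists_presentation_adjoin_frobTwist`).

## What is NOT here

Uniqueness statements beyond the Hilbert function (which pivots / which flags of subspaces are
intrinsic), Giraud's Lemme 1.7 (normalised generators `F_i` of the tangent-cone ideal versus the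
`σ_i`), the ridge as a group scheme and its representability (`Ridge.lean`,
`RidgeRepresentable.lean`), and any statement about Hironaka's 2017 resolution claim.

## References

* H. Hironaka, *Additive groups associated with points of a projective space*, Ann. of Math. 92
  (1970) 327–334 (the triangular basis theorem). [Hironaka1970AdditiveGroups]
* J. Giraud, *Contact maximal en caractéristique positive*, Ann. Sci. ÉNS (4) 8 (1975) 201–234,
  §1.5–1.7, esp. (3) p. 204 and p. 205. doi:10.24033/asens.1286 [Giraud1975]
* T. Oda, *Hironaka's additive group scheme II*, Publ. RIMS 19 (1983) 1163–1179 (background).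
  [Oda1983HironakaGroupSchemeII]
* H. Kawanoue, *Toward resolution of singularities over a field of positive characteristic I*,
  Publ. RIMS 43 (2007) 819–909, Lemma 3.1.2.1 (the perfect / algebraically closed case).
  [Kawanoue2007]
-/

open MvPolynomial

namespace Literature.AlgebraicGeometry.Resolution

variable {σ : Type*} [Fintype σ] [DecidableEq σ] {K : Type*} [Field K]

section AdditiveForms

/-! ### Additive diagonal forms `Σ_k c_k x_k^q` -/

omit [DecidableEq σ] in
/-- The `x_i^q`-coefficient of `Σ_k c_k x_k^q` is `c_i` (`q > 0`). [folklore] -/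
theorem coeff_single_sum_C_mul_X_pow (c : σ → K) {q : ℕ} (hq : 0 < q) (i : σ) :
    coeff (Finsupp.single i q) (∑ k, C (c k) * X k ^ q : MvPolynomial σ K) = c i := by
  classical
  rw [coeff_sum]
  simp_rw [coeff_C_mul, coeff_X_pow]
  rw [Finset.sum_eq_single i (fun k _ hk => ?_) (fun h => absurd (Finset.mem_univ i) h), if_pos rfl,
    mul_one]
  rw [if_neg (fun h => hk (Finsupp.single_left_injective hq.ne' h)), mul_zero]

omit [DecidableEq σ] in
/-- `Σ_k c_k x_k^q` is homogeneous of degree `q`. [folklore] -/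
theorem isHomogeneous_sum_C_mul_X_pow (c : σ → K) (q : ℕ) :
    (∑ k, C (c k) * X k ^ q : MvPolynomial σ K).IsHomogeneous q := by
  refine IsHomogeneous.sum _ _ _ fun k _ => ?_
  simpa using (isHomogeneous_C σ (c k)).mul ((isHomogeneous_X K k).pow q)

omit [DecidableEq σ] in
/-- `Σ_k c_k x_k^q = 0` iff all `c_k = 0` (`q > 0`). [folklore] -/
theorem sum_C_mul_X_pow_eq_zero_iff (c : σ → K) {q : ℕ} (hq : 0 < q) :
    (∑ k, C (c k) * X k ^ q : MvPolynomial σ K) = 0 ↔ ∀ k, c k = 0 := by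
  constructor
  · intro h k
    rw [← coeff_single_sum_C_mul_X_pow c hq k, h, coeff_zero]
  · intro h
    exact Finset.sum_eq_zero fun k _ => by rw [h k, C_0, zero_mul]

omit [DecidableEq σ] in
/-- If `c_i = 0` then `x_i` does not occur in `Σ_k c_k x_k^q`. [folklore] -/
theorem degreeOf_sum_C_mul_X_pow_eq_zero {c : σ → K} {i : σ} (hi : c i = 0) (q : ℕ) :
    degreeOf i (∑ k, C (c k) * X k ^ q : MvPolynomial σ K) = 0 := by
  apply Nat.eq_zero_of_le_zero
  refine (degreeOf_sum_le i _ _).trans (Finset.sup_le fun k _ => ?_)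
  by_cases hk : i = k
  · subst hk
    rw [hi, C_0, zero_mul, degreeOf_zero]
  · exact (degreeOf_C_mul_le _ _ _).trans (degreeOf_X_pow_of_ne q hk).le

omit [DecidableEq σ] in
/-- If `c_i = 0` then `x_i ∉ vars (Σ_k c_k x_k^q)`. [folklore] -/
theorem notMem_vars_sum_C_mul_X_pow {c : σ → K} {i : σ} (hi : c i = 0) (q : ℕ) :
    i ∉ (∑ k, C (c k) * X k ^ q : MvPolynomial σ K).vars := by
  rw [mem_vars_iff_degreeOf_ne_zero, degreeOf_sum_C_mul_X_pow_eq_zero hi q]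
  exact fun h => h rfl

omit [DecidableEq σ] in
/-- `Σ_k c_k x_k^q` involves only the variables `x_k` with `c_k ≠ 0`. [folklore] -/
theorem sum_C_mul_X_pow_mem_supported {c : σ → K} {S : Set σ} (hc : ∀ k, c k ≠ 0 → k ∈ S)
    (q : ℕ) : (∑ k, C (c k) * X k ^ q : MvPolynomial σ K) ∈ supported K S := by
  refine sum_mem fun k _ => ?_
  by_cases hk : c k = 0
  · rw [hk, C_0, zero_mul]
    exact zero_mem _
  · refine mul_mem ?_ (pow_mem (X_mem_supported.mpr (hc k hk)) q)
    rw [← MvPolynomial.algebraMap_eq]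
    exact Subalgebra.algebraMap_mem _ _

omit [DecidableEq σ] in
/-- Splitting off a pivot with coefficient `1`: `Σ_k c_k x_k^q = x_i^q + Σ_{k ≠ i} c_k x_k^q`.
[folklore] -/
theorem sum_C_mul_X_pow_eq_X_pow_add [DecidableEq σ] {c : σ → K} {i : σ} (hi : c i = 1) (q : ℕ) :
    (∑ k, C (c k) * X k ^ q : MvPolynomial σ K) =
      X i ^ q + ∑ k, C (Function.update c i 0 k) * X k ^ q := by
  have h1 : ∀ f : σ → MvPolynomial σ K, Finset.univ.sum f = f i + (Finset.univ.erase i).sum f :=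
    fun f => (Finset.add_sum_erase _ f (Finset.mem_univ i)).symm
  rw [h1, h1 (fun k => C (Function.update c i 0 k) * X k ^ q)]
  simp only [hi, C_1, one_mul, Function.update_self, C_0, zero_mul, zero_add]
  congr 1
  exact Finset.sum_congr rfl fun k hk => by rw [Function.update_of_ne (Finset.ne_of_mem_erase hk)]

/-- **All Hasse–Schmidt derivatives of positive order of an additive `p^e`-form
`Σ_k c_k x_k^{p^e}` are constants**, `p` the exponential characteristic. [folklore] -/
theorem exists_hasseDeriv_sum_C_mul_X_pow_eq_C (p : ℕ) [ExpChar K p] (c : σ → K) (e : ℕ)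
    {β : σ →₀ ℕ} (hβ : β ≠ 0) :
    ∃ a : K, hasseDeriv K β (∑ k, C (c k) * X k ^ p ^ e : MvPolynomial σ K) = C a := by
  choose a ha using fun k => exists_hasseDeriv_X_pow_expChar_pow_eq_C (K := K) p k e hβ
  refine ⟨∑ k, c k * a k, ?_⟩
  rw [map_sum, map_sum]
  refine Finset.sum_congr rfl fun k _ => ?_
  rw [C_mul', map_smul, ha k, ← C_mul', ← C_mul]

/-- **`K[σ_1, …, σ_r]` with `σ_j = Σ_k c_{jk} x_k^{p^{e_j}}` is stable under all Hasse–Schmidt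
derivations**, for any coefficients, over any field of exponential characteristic `p`.
[folklore] -/
theorem isDiffStable_adjoin_sum_C_mul_X_pow (p : ℕ) [ExpChar K p] {ι : Type*} (c : ι → σ → K)
    (e : ι → ℕ) :
    IsDiffStable (Algebra.adjoin K
      (Set.range fun j => (∑ k, C (c j k) * X k ^ p ^ e j : MvPolynomial σ K))) := by
  refine IsDiffStable.adjoin fun s hs β => ?_
  obtain ⟨j, rfl⟩ := hs
  show hasseDeriv K β (∑ k, C (c j k) * X k ^ p ^ e j) ∈ _
  by_cases hβ : β = 0
  · subst hβ
    rw [hasseDeriv_zero, LinearMap.id_apply]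
    exact Algebra.subset_adjoin ⟨j, rfl⟩
  · obtain ⟨a, ha⟩ := exists_hasseDeriv_sum_C_mul_X_pow_eq_C p (c j) (e j) hβ
    rw [ha, ← MvPolynomial.algebraMap_eq]
    exact Subalgebra.algebraMap_mem _ a

omit [DecidableEq σ] in
/-- `K[σ_1, …, σ_r]` with `σ_j = Σ_k c_{jk} x_k^{q_j}` is a graded subalgebra. [folklore] -/
theorem isGradedSubalgebra_adjoin_sum_C_mul_X_pow {ι : Type*} (c : ι → σ → K) (q : ι → ℕ) :
    IsGradedSubalgebra (Algebra.adjoin K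
      (Set.range fun j => (∑ k, C (c j k) * X k ^ q j : MvPolynomial σ K))) := by
  refine IsGradedSubalgebra.adjoin ?_
  rintro _ ⟨j, rfl⟩
  exact ⟨q j, isHomogeneous_sum_C_mul_X_pow (c j) (q j)⟩

end AdditiveForms

section Peeling

/-! ### Peeling off `x_{i₀}` along `s₀ = x_{i₀}^{p^e} + τ`, `τ` free of `x_{i₀}` -/

omit [Fintype σ] [DecidableEq σ] in
/-- `deg_{x_i} (x_i^q + τ) = q` if `x_i` does not occur in `τ` (`q > 0`). [folklore] -/
theorem degreeOf_X_pow_add_eq {i : σ} {q : ℕ} (hq : 0 < q) {τ : MvPolynomial σ K}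
    (hτ : τ.degreeOf i = 0) : (X i ^ q + τ).degreeOf i = q := by
  rw [degreeOf_add_eq_of_degreeOf_lt, degreeOf_X_self_pow]
  rw [degreeOf_X_self_pow, hτ]
  exact hq

omit [Fintype σ] [DecidableEq σ] in
/-- **`deg_{x_i} ((x_i^q + τ)^c − x_i^{qc}) < qc`** for `τ` free of `x_i` and `q, c > 0`: the
powers of `s₀ = x_i^q + τ` have the same top `x_i`-layer as those of `x_i^q`. [folklore] -/
theorem degreeOf_pow_sub_X_pow_lt {i : σ} {q : ℕ} (hq : 0 < q) {τ : MvPolynomial σ K}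
    (hτ : τ.degreeOf i = 0) {c : ℕ} (hc : 0 < c) :
    ((X i ^ q + τ) ^ c - X i ^ (q * c)).degreeOf i < q * c := by
  obtain ⟨c, rfl⟩ := Nat.exists_eq_succ_of_ne_zero hc.ne'
  induction c with
  | zero =>
    rw [Nat.succ_eq_add_one, zero_add, pow_one, mul_one, add_sub_cancel_left, hτ]
    exact hq
  | succ c ih =>
    have key : (X i ^ q + τ) ^ (c + 1).succ - X i ^ (q * (c + 1).succ) =
        ((X i ^ q + τ) ^ c.succ - X i ^ (q * c.succ)) * X i ^ q + (X i ^ q + τ) ^ c.succ * τ := by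
      simp only [Nat.succ_eq_add_one]
      ring
    rw [key]
    refine (degreeOf_add_le _ _ _).trans_lt (max_lt ?_ ?_)
    · refine (degreeOf_mul_le _ _ _).trans_lt ?_
      rw [degreeOf_X_self_pow]
      have := ih (Nat.succ_pos c)
      simp only [Nat.succ_eq_add_one] at this ⊢
      have h3 : q * (c + 1 + 1) = q * (c + 1) + q := by ring
      omega
    · refine (degreeOf_mul_le _ _ _).trans_lt ?_
      rw [hτ, add_zero]
      refine (degreeOf_pow_le _ _ _).trans_lt ?_
      have h1 : (X i ^ q + τ).degreeOf i ≤ q := by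
        refine (degreeOf_add_le _ _ _).trans ?_
        rw [degreeOf_X_self_pow, hτ]
        exact max_le le_rfl (Nat.zero_le _)
      calc c.succ * (X i ^ q + τ).degreeOf i ≤ c.succ * q := Nat.mul_le_mul_left _ h1
        _ < q * (c + 1).succ := by
          simp only [Nat.succ_eq_add_one]
          nlinarith

omit [Fintype σ] in
/-- **Key lemma 4′ (peeling off `x_{i₀}` along `s₀`).** If `U` is graded and differentially
stable, `s₀ = x_{i₀}^{p^e} + τ ∈ U` with `τ` free of `x_{i₀}`, and `U` has no forms in degrees
`0 < d < p^e`, then `U` is generated by `s₀` together with its elements not involving `x_{i₀}`.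
(The perfect-field version `le_adjoin_insert_X_pow_of_minDeg` is the case `τ = 0`.)
[cite: Giraud1975, §1.6 (3)] [cite: Hironaka1970AdditiveGroups] -/
theorem le_adjoin_insert_X_pow_add_of_minDeg (p : ℕ) [ExpChar K p]
    {U : Subalgebra K (MvPolynomial σ K)} (hUg : IsGradedSubalgebra U) (hUd : IsDiffStable U)
    {i₀ : σ} {e : ℕ} {s₀ τ : MvPolynomial σ K} (hsU : s₀ ∈ U) (hsτ : s₀ = X i₀ ^ p ^ e + τ)
    (hτ : τ.degreeOf i₀ = 0)
    (hmin : ∀ d, 0 < d → d < p ^ e → ∀ g ∈ U, g.IsHomogeneous d → g = 0) :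
    U ≤ Algebra.adjoin K (insert s₀ {g | g ∈ U ∧ i₀ ∉ g.vars}) := by
  have hq : 0 < p ^ e := pow_pos (expChar_pos K p) e
  set A := Algebra.adjoin K (insert s₀ {g | g ∈ U ∧ i₀ ∉ g.vars}) with hA
  have hdiv := dvd_of_mem_support_of_minDeg' p hUg hUd i₀ hmin
  suffices h : ∀ n, ∀ f ∈ U, f.degreeOf i₀ ≤ n → f ∈ A from fun f hf => h _ f hf le_rfl
  intro n
  induction n with
  | zero =>
    intro f hf hdeg
    have ht : ∀ α ∈ f.support, α i₀ ≤ 0 := fun α hα => (monomial_le_degreeOf i₀ hα).trans hdeg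
    have hf0 : f = coeffX K i₀ 0 f := by
      rw [← sub_eq_zero]
      ext α
      have h := coeff_sub_X_pow_mul_coeffX K i₀ 0 f α
      rw [pow_zero, one_mul] at h
      rw [h, coeff_zero]
      split_ifs with h0
      · rfl
      · exact notMem_support_iff.mp fun hα => h0 (Nat.le_zero.mp (ht α hα))
    have hfT : f ∈ {g | g ∈ U ∧ i₀ ∉ g.vars} :=
      ⟨hf, by rw [hf0]; exact notMem_vars_coeffX K i₀ 0 f⟩
    exact Algebra.subset_adjoin (Set.mem_insert_of_mem _ hfT)
  | succ n ih =>
    intro f hf hdeg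
    by_cases hle : f.degreeOf i₀ ≤ n
    · exact ih f hf hle
    have ht : f.degreeOf i₀ = n + 1 := by omega
    have htop : ∀ α ∈ f.support, α i₀ ≤ n + 1 :=
      fun α hα => (monomial_le_degreeOf i₀ hα).trans hdeg
    -- the top coefficient `g` is in `U` (a Hasse–Schmidt derivative of `f`) and free of `x_{i₀}`
    set g := coeffX K i₀ (n + 1) f with hg
    have hgU : g ∈ U := by
      rw [hg, ← hasseDeriv_single_eq_coeffX K i₀ (n + 1) htop]; exact hUd f hf _
    have hgA : g ∈ A :=
      Algebra.subset_adjoin (Set.mem_insert_of_mem _ ⟨hgU, notMem_vars_coeffX K i₀ (n + 1) f⟩)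
    have hg0 : g.degreeOf i₀ = 0 := by
      have := notMem_vars_coeffX K i₀ (n + 1) f
      rwa [mem_vars_iff_degreeOf_ne_zero, not_not] at this
    -- `p^e ∣ n + 1`, an exponent of `x_{i₀}` that occurs in `f`
    have hdvd : p ^ e ∣ n + 1 := by
      have hne : f.support.Nonempty := by
        rw [Finset.nonempty_iff_ne_empty, Ne, support_eq_empty]
        rintro rfl
        rw [degreeOf_zero] at ht
        omega
      obtain ⟨α, hα, hαt⟩ := Finset.exists_mem_eq_sup _ hne (fun m : σ →₀ ℕ => m i₀)
      rw [← degreeOf_eq_sup, ht] at hαt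
      rw [hαt]
      exact hdiv f hf α hα
    obtain ⟨c, hc⟩ := hdvd
    have hc0 : 0 < c := Nat.pos_of_ne_zero (by rintro rfl; simp at hc)
    have hscU : s₀ ^ c ∈ U := pow_mem hsU c
    have hscA : s₀ ^ c ∈ A := pow_mem (Algebra.subset_adjoin (Set.mem_insert _ _)) c
    -- peel off the top layer along `s₀^c` and conclude by induction
    have hf'U : f - s₀ ^ c * g ∈ U := sub_mem hf (mul_mem hscU hgU)
    have hf'deg : (f - s₀ ^ c * g).degreeOf i₀ ≤ n := by
      have h1 : (f - X i₀ ^ (n + 1) * g).degreeOf i₀ < n + 1 := by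
        rw [degreeOf_lt_iff (by omega)]
        intro α hα
        rw [mem_support_iff, hg, coeff_sub_X_pow_mul_coeffX] at hα
        split_ifs at hα with hαt
        · exact absurd rfl hα
        · exact lt_of_le_of_ne (htop α (mem_support_iff.mpr hα)) hαt
      have h2 : ((s₀ ^ c - X i₀ ^ (n + 1)) * g).degreeOf i₀ < n + 1 := by
        refine (degreeOf_mul_le _ _ _).trans_lt ?_
        rw [hg0, add_zero, hc, hsτ]
        exact degreeOf_pow_sub_X_pow_lt hq hτ hc0
      have heq : f - s₀ ^ c * g = (f - X i₀ ^ (n + 1) * g) - (s₀ ^ c - X i₀ ^ (n + 1)) * g := by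
        ring
      rw [heq]
      have := (degreeOf_sub_le i₀ _ _).trans_lt (max_lt h1 h2)
      omega
    have hf'A := ih _ hf'U hf'deg
    have : f = (f - s₀ ^ c * g) + s₀ ^ c * g := by ring
    rw [this]
    exact add_mem hf'A (mul_mem hscA hgA)

omit [Fintype σ] [DecidableEq σ] in
/-- **`x_i^q + τ` is transcendental over every subalgebra of `K[x_k : k ∈ s]`, `i ∉ s`**, for
`τ ∈ K[x_k : k ∈ s]` and `q > 0`. [folklore] -/
theorem transcendental_X_pow_add_of_le_supported {i : σ} {s : Set σ} (hi : i ∉ s) {q : ℕ}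
    (hq : 0 < q) {τ : MvPolynomial σ K} (hτ : τ ∈ supported K s)
    {A : Subalgebra K (MvPolynomial σ K)} (hA : A ≤ supported K s) :
    Transcendental A (X i ^ q + τ) := by
  have hB : Transcendental (supported K s) (X i ^ q + τ) := by
    have h1 : Transcendental (supported K s) (X i : MvPolynomial σ K) :=
      transcendental_supported_X K hi
    have h2 : Transcendental (supported K s)
        (Polynomial.X ^ q + Polynomial.C (⟨τ, hτ⟩ : supported K s)) :=
      Polynomial.transcendental _ (by rw [Polynomial.natDegree_X_pow_add_C]; exact hq.ne')
        (by rw [Polynomial.leadingCoeff_X_pow_add_C hq]; exact one_mem _)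
    have h3 := h1.aeval_of_transcendental h2
    simpa using h3
  exact hB.of_tower_top_of_subalgebra_le hA

end Peeling

section Structure

/-! ### The structure theorem over an arbitrary field -/

/-- **Main induction** (on the set `S` of variables allowed; arbitrary field `K` of exponential
characteristic `p`): a graded, differentially stable `K`-subalgebra `U ⊆ K[x_k : k ∈ S]` is
`K[σ_1, …, σ_r]` for additive forms `σ_j = Σ_{k ∈ S} c_{jk} x_k^{q_j}`, `q_j` `p`-powers with
`q_1 ≤ … ≤ q_r`, in echelon form with respect to distinct pivots `ι(j) ∈ S` (`c_{j ι(j)} = 1`,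
`c_{j ι(j')} = 0` for `j' < j`), the `σ_j` algebraically independent.
[cite: Hironaka1970AdditiveGroups] [cite: Giraud1975, §1.6 (3)] -/
theorem exists_adjoin_triangular_eq_aux (p : ℕ) [ExpChar K p] (S : Finset σ) :
    ∀ (U : Subalgebra K (MvPolynomial σ K)), IsGradedSubalgebra U → IsDiffStable U →
      U ≤ supported K (↑S : Set σ) →
      ∃ (r : ℕ) (ι : Fin r → σ) (q : Fin r → ℕ) (c : Fin r → σ → K),
        (∀ j, ι j ∈ S) ∧ Function.Injective ι ∧ (∀ j, ∃ e, q j = p ^ e) ∧ Monotone q ∧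
        (∀ j k, c j k ≠ 0 → k ∈ S) ∧ (∀ j, c j (ι j) = 1) ∧
        (∀ j j', j' < j → c j (ι j') = 0) ∧
        AlgebraicIndependent K (fun j => (∑ k, C (c j k) * X k ^ q j : MvPolynomial σ K)) ∧
        U = Algebra.adjoin K
          (Set.range fun j => (∑ k, C (c j k) * X k ^ q j : MvPolynomial σ K)) := by
  induction S using Finset.strongInduction with
  | H S ih =>
  intro U hUg hUd hUS
  have hp : 0 < p := expChar_pos K p
  by_cases hbot : U ≤ ⊥
  · refine ⟨0, Fin.elim0, Fin.elim0, Fin.elim0, fun j => j.elim0, fun j => j.elim0,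
      fun j => j.elim0, fun j => j.elim0, fun j => j.elim0, fun j => j.elim0, fun j => j.elim0,
      algebraicIndependent_empty_type, ?_⟩
    rw [Set.range_eq_empty, Algebra.adjoin_empty]
    exact le_antisymm hbot bot_le
  -- a non-constant element of `U`, hence (gradedness) a nonzero form of positive degree in `U`
  obtain ⟨f, hfU, hfbot⟩ := SetLike.not_le_iff_exists.mp hbot
  have hex : ∃ d, 0 < d ∧ ∃ g ∈ U, g.IsHomogeneous d ∧ g ≠ 0 := by
    by_contra hne
    push Not at hne
    apply hfbot
    have hfC : f = C (coeff 0 f) := by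
      conv_lhs => rw [← sum_homogeneousComponent f]
      rw [Finset.sum_eq_single 0, homogeneousComponent_zero]
      · intro d _ hd
        exact hne d (Nat.pos_of_ne_zero hd) _ (hUg f hfU d) (homogeneousComponent_isHomogeneous d f)
      · intro h; simp at h
    rw [hfC, ← MvPolynomial.algebraMap_eq]
    exact Subalgebra.algebraMap_mem _ _
  -- the least positive degree `q₀ = p^e` in which `U` has a nonzero form `g₀ = Σ_k a_k x_k^{p^e}`
  classical
  obtain ⟨q₀, ⟨hq, g₀, hg₀U, hg₀h, hg₀0⟩, hqmin⟩ : ∃ q₀, (0 < q₀ ∧ ∃ g ∈ U, g.IsHomogeneous q₀ ∧ g ≠ 0) ∧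
      ∀ d < q₀, ¬ (0 < d ∧ ∃ g ∈ U, g.IsHomogeneous d ∧ g ≠ 0) :=
    ⟨Nat.find hex, Nat.find_spec hex, fun d hd => Nat.find_min hex hd⟩
  have hmin : ∀ d, 0 < d → d < q₀ → ∀ g ∈ U, g.IsHomogeneous d → g = 0 := by
    intro d hd hdq g hg hgh
    by_contra hg0
    exact hqmin d hdq ⟨hd, g, hg, hgh, hg0⟩
  obtain ⟨e, hqe⟩ := exists_eq_pow_of_minDeg p hUd hq hmin hg₀U hg₀h hg₀0
  subst hqe
  have hsupp := support_subset_single_of_minDeg hUd hq hmin hg₀U hg₀h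
  set a : σ → K := fun i => coeff (Finsupp.single i (p ^ e)) g₀ with ha
  have hg₀eq : g₀ = ∑ i, C (a i) * X i ^ p ^ e := eq_sum_X_pow_of_support_subset_single hq hsupp
  have a_zero : ∀ i, i ∉ S → a i = 0 := by
    intro i hi
    by_contra h
    have hmem : Finsupp.single i (p ^ e) ∈ g₀.support := mem_support_iff.mpr h
    apply hi
    have hvars := mem_supported.mp (hUS hg₀U)
    have : i ∈ (↑g₀.vars : Set σ) := by
      rw [Finset.mem_coe, mem_vars_iff_mem_support]
      exact ⟨_, hmem, by rw [Finsupp.mem_support_iff, Finsupp.single_eq_same]; exact hq.ne'⟩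
    exact hvars this
  obtain ⟨i₀, hi₀⟩ : ∃ i, a i ≠ 0 := by
    by_contra h
    push Not at h
    apply hg₀0
    rw [hg₀eq]
    exact Finset.sum_eq_zero fun i _ => by rw [h i, C_0, zero_mul]
  have hi₀S : i₀ ∈ S := by
    by_contra h
    exact hi₀ (a_zero i₀ h)
  -- normalise: `s₀ = a_{i₀}⁻¹ g₀ = x_{i₀}^{p^e} + τ ∈ U`, `τ = Σ_{k ≠ i₀} c₀_k x_k^{p^e}`
  set c₀ : σ → K := fun k => a k / a i₀ with hc₀
  have hc₀i : c₀ i₀ = 1 := div_self hi₀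
  have hc₀S : ∀ k, c₀ k ≠ 0 → k ∈ S := by
    intro k hk
    by_contra h
    apply hk
    simp only [hc₀, a_zero k h, zero_div]
  set s₀ : MvPolynomial σ K := ∑ k, C (c₀ k) * X k ^ p ^ e with hs₀
  have hs₀U : s₀ ∈ U := by
    have heq : s₀ = C (a i₀)⁻¹ * g₀ := by
      rw [hg₀eq, Finset.mul_sum]
      refine Finset.sum_congr rfl fun k _ => ?_
      rw [← mul_assoc, ← map_mul]
      simp only [hc₀, div_eq_inv_mul]
    rw [heq]
    have hC : C (a i₀)⁻¹ ∈ U := by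
      rw [← MvPolynomial.algebraMap_eq]; exact Subalgebra.algebraMap_mem _ _
    exact mul_mem hC hg₀U
  set τ : MvPolynomial σ K := ∑ k, C (Function.update c₀ i₀ 0 k) * X k ^ p ^ e with hτdef
  have hs₀τ : s₀ = X i₀ ^ p ^ e + τ := sum_C_mul_X_pow_eq_X_pow_add hc₀i _
  have hτdeg : τ.degreeOf i₀ = 0 :=
    degreeOf_sum_C_mul_X_pow_eq_zero (Function.update_self i₀ (0 : K) c₀) _
  have hτsup : τ ∈ supported K (↑(S.erase i₀) : Set σ) := by
    refine sum_C_mul_X_pow_mem_supported (fun k hk => ?_) _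
    rw [Finset.coe_erase, Set.mem_sdiff, Set.mem_singleton_iff]
    by_cases hki : k = i₀
    · subst hki
      rw [Function.update_self] at hk
      exact absurd rfl hk
    · rw [Function.update_of_ne hki] at hk
      exact ⟨hc₀S k hk, hki⟩
  -- peel off `x_{i₀}`: `U = K[s₀, U₂]` with `U₂ = U ∩ K[x_k : k ∈ S \ {i₀}]`, and induct
  have hpeel := le_adjoin_insert_X_pow_add_of_minDeg p hUg hUd hs₀U hs₀τ hτdeg hmin
  set U₂ := U ⊓ supported K (↑(S.erase i₀) : Set σ) with hU₂
  obtain ⟨r, ι', q', c', hι'S, hι'inj, hq'pow, hq'mono, hc'S, hc'piv, hc'tri, hai', hU₂eq⟩ :=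
    ih (S.erase i₀) (Finset.erase_ssubset hi₀S) U₂ (hUg.inf_supported _) (hUd.inf_supported _)
      inf_le_right
  set g' : Fin r → MvPolynomial σ K := fun j => ∑ k, C (c' j k) * X k ^ q' j with hg'
  have hT : {g | g ∈ U ∧ i₀ ∉ g.vars} ⊆ (U₂ : Set (MvPolynomial σ K)) := by
    rintro g ⟨hg, hgi⟩
    refine Algebra.mem_inf.mpr ⟨hg, ?_⟩
    rw [mem_supported]
    intro j hj
    have hjS := mem_supported.mp (hUS hg) hj
    rw [Finset.coe_erase]
    exact ⟨hjS, fun h => hgi (by rw [Set.mem_singleton_iff] at h; exact h ▸ hj)⟩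
  have hg'U₂ : ∀ j, g' j ∈ U₂ := fun j => by rw [hU₂eq]; exact Algebra.subset_adjoin ⟨j, rfl⟩
  have hg'U : ∀ j, g' j ∈ U := fun j => (Algebra.mem_inf.mp (hg'U₂ j)).1
  have hUeq : U = Algebra.adjoin K (insert s₀ (Set.range g')) := by
    apply le_antisymm
    · refine hpeel.trans ?_
      have hins : Algebra.adjoin K (insert s₀ (Set.range g')) =
          Algebra.adjoin K (insert s₀ (U₂ : Set (MvPolynomial σ K))) := by
        rw [hU₂eq, Algebra.adjoin_insert_adjoin]
      rw [hins]
      exact Algebra.adjoin_mono (Set.insert_subset_insert hT)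
    · rw [Algebra.adjoin_le_iff]
      rintro g (rfl | ⟨j, rfl⟩)
      · exact hs₀U
      · exact hg'U j
  -- `p^e ≤ q'_j`: the `g'_j ∈ U` are nonzero forms of degree `q'_j`
  have hq'pos : ∀ j, 0 < q' j := fun j => by
    obtain ⟨e', he'⟩ := hq'pow j; rw [he']; exact pow_pos hp e'
  have hle : ∀ j, p ^ e ≤ q' j := by
    intro j
    by_contra hlt
    push Not at hlt
    refine hqmin (q' j) hlt ⟨hq'pos j, g' j, hg'U j, isHomogeneous_sum_C_mul_X_pow _ _, ?_⟩
    intro h0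
    have := (sum_C_mul_X_pow_eq_zero_iff (c' j) (hq'pos j)).mp h0 (ι' j)
    rw [hc'piv j] at this
    exact one_ne_zero this
  -- `s₀` is transcendental over `K[g'] ⊆ K[x_k : k ≠ i₀]`
  have hAle : Algebra.adjoin K (Set.range g') ≤ supported K (↑(S.erase i₀) : Set σ) := by
    rw [← hU₂eq]; exact inf_le_right
  have htrans : Transcendental (Algebra.adjoin K (Set.range g')) s₀ := by
    rw [hs₀τ]
    exact transcendental_X_pow_add_of_le_supported (by simp) hq hτsup hAle
  have hai : AlgebraicIndependent K (Fin.cons s₀ g' : Fin (r + 1) → MvPolynomial σ K) := by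
    have h1 : AlgebraicIndependent K (fun o : Option (Fin r) => o.elim s₀ g') :=
      AlgebraicIndependent.option_iff.mpr ⟨hai', htrans⟩
    refine (algebraicIndependent_equiv' (finSuccEquiv r) ?_).mpr h1
    funext j
    refine Fin.cases ?_ (fun j => ?_) j
    · simp [finSuccEquiv_zero]
    · simp [finSuccEquiv_succ]
  have hfun : (fun j : Fin (r + 1) => (∑ k, C ((Fin.cons c₀ c' : Fin (r + 1) → σ → K) j k) *
      X k ^ (Fin.cons (p ^ e) q' : Fin (r + 1) → ℕ) j : MvPolynomial σ K)) =
      (Fin.cons s₀ g' : Fin (r + 1) → MvPolynomial σ K) := by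
    funext j
    refine Fin.cases ?_ (fun j => ?_) j
    · simp only [Fin.cons_zero, hs₀]
    · simp only [Fin.cons_succ, hg']
  refine ⟨r + 1, Fin.cons i₀ ι', Fin.cons (p ^ e) q', Fin.cons c₀ c', ?_, ?_, ?_, ?_, ?_, ?_, ?_,
    ?_, ?_⟩
  · -- pivots lie in `S`
    refine Fin.cases ?_ (fun j => ?_)
    · simpa using hi₀S
    · simpa using Finset.mem_of_mem_erase (hι'S j)
  · -- pivots are distinct
    refine Fin.cons_injective_iff.mpr ⟨?_, hι'inj⟩
    rintro ⟨j, hj⟩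
    have := hι'S j
    rw [hj] at this
    exact Finset.notMem_erase i₀ S this
  · -- `p`-power degrees
    refine Fin.cases ?_ (fun j => ?_)
    · exact ⟨e, by simp⟩
    · simpa using hq'pow j
  · -- sorted degrees
    intro x y
    refine Fin.cases ?_ (fun x => ?_) x <;> refine Fin.cases ?_ (fun y => ?_) y <;> intro hxy
    · simp
    · simp only [Fin.cons_zero, Fin.cons_succ]
      exact hle y
    · exact absurd hxy (not_le.mpr (Fin.succ_pos x))
    · simp only [Fin.cons_succ]
      exact hq'mono (Fin.succ_le_succ_iff.mp hxy)
  · -- coefficients supported on `S`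
    refine Fin.cases ?_ (fun j => ?_)
    · intro k hk
      exact hc₀S k (by simpa using hk)
    · intro k hk
      exact Finset.mem_of_mem_erase (hc'S j k (by simpa using hk))
  · -- pivot coefficients are `1`
    refine Fin.cases ?_ (fun j => ?_)
    · simpa using hc₀i
    · simpa using hc'piv j
  · -- echelon form
    intro j j'
    refine Fin.cases ?_ (fun j => ?_) j <;> refine Fin.cases ?_ (fun j' => ?_) j' <;> intro hjj'
    · exact absurd hjj' (lt_irrefl _)
    · exact absurd hjj' (not_lt.mpr (Fin.zero_le _))
    · simp only [Fin.cons_succ, Fin.cons_zero]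
      by_contra h
      exact Finset.notMem_erase i₀ S (hc'S j i₀ h)
    · simp only [Fin.cons_succ]
      exact hc'tri j j' (Fin.succ_lt_succ_iff.mp hjj')
  · -- algebraic independence
    rw [hfun]; exact hai
  · -- `U = K[s₀, g'_j]`
    rw [hfun, Fin.range_cons]; exact hUeq

/-- **Structure theorem for graded, differentially stable subalgebras of a polynomial ring over an
arbitrary field — Hironaka's triangular additive basis** (Hironaka 1970; Giraud 1975, §1.6 (3)).
For `U ⊆ K[x_i : i ∈ σ]` graded and stable under all Hasse–Schmidt derivations, `K` any field of
exponential characteristic `p`, there are `r ≤ #σ` distinct pivot variables `ι(j)`, exponents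
`e_1 ≤ … ≤ e_r` and coefficients `c_{jk} ∈ K` in echelon form (`c_{j ι(j)} = 1`, `c_{j ι(j')} = 0`
for `j' < j`) such that the additive forms `σ_j = Σ_k c_{jk} x_k^{p^{e_j}}` are algebraically
independent over `K` and `U = K[σ_1, …, σ_r]`.
[cite: Hironaka1970AdditiveGroups] [cite: Giraud1975, §1.6 (3), p. 204] -/
theorem exists_eq_adjoin_triangular_of_isDiffStable (p : ℕ) [ExpChar K p]
    (U : Subalgebra K (MvPolynomial σ K)) (hUg : IsGradedSubalgebra U) (hUd : IsDiffStable U) :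
    ∃ (r : ℕ) (ι : Fin r → σ) (e : Fin r → ℕ) (c : Fin r → σ → K),
      r ≤ Fintype.card σ ∧ Function.Injective ι ∧ Monotone e ∧
      (∀ j, c j (ι j) = 1) ∧ (∀ j j', j' < j → c j (ι j') = 0) ∧
      AlgebraicIndependent K
        (fun j => (∑ k, C (c j k) * X k ^ p ^ e j : MvPolynomial σ K)) ∧
      U = Algebra.adjoin K
        (Set.range fun j => (∑ k, C (c j k) * X k ^ p ^ e j : MvPolynomial σ K)) := by
  obtain ⟨r, ι, q, c, -, hιinj, hqpow, hqmono, -, hcpiv, hctri, hai, hU⟩ :=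
    exists_adjoin_triangular_eq_aux p (Finset.univ : Finset σ) U hUg hUd
      (by rw [Finset.coe_univ, supported_univ]; exact le_top)
  have hr : r ≤ Fintype.card σ := by
    simpa using Fintype.card_le_of_injective ι hιinj
  -- exponents: `q_j = p^{e_j}` with `e` sorted (for `p = 1` take `e = 0`)
  obtain ⟨e, he, hemono⟩ : ∃ e : Fin r → ℕ, (∀ j, q j = p ^ e j) ∧ Monotone e := by
    cases ‹ExpChar K p› with
    | zero =>
      refine ⟨fun _ => 0, fun j => ?_, fun _ _ _ => le_rfl⟩
      obtain ⟨e, he⟩ := hqpow j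
      rw [he, one_pow, pow_zero]
    | prime hp =>
      choose e he using hqpow
      refine ⟨e, he, fun j j' hjj' => ?_⟩
      have := hqmono hjj'
      rw [he, he] at this
      exact (Nat.pow_le_pow_iff_right hp.one_lt).mp this
  have hfun : (fun j => (∑ k, C (c j k) * X k ^ q j : MvPolynomial σ K)) =
      fun j => ∑ k, C (c j k) * X k ^ p ^ e j := funext fun j => by rw [he]
  refine ⟨r, ι, e, c, hr, hιinj, hemono, hcpiv, hctri, ?_, ?_⟩
  · rw [← hfun]; exact hai
  · rw [← hfun]; exact hU

/-- **Structure theorem in `K[x_1, …, x_n]`, arbitrary field** (the form relevant to the edge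
algebra `G(ξ)` at a NON-closed point `ξ`, residue field `κ(ξ)` possibly imperfect): `U` is a
polynomial ring on `r ≤ n` algebraically independent additive triangular forms
`σ_j = x_{ι(j)}^{p^{e_j}} + Σ_{k ∉ {ι(1),…,ι(j)}} c_{jk} x_k^{p^{e_j}}`, `e_1 ≤ … ≤ e_r`.
[cite: Hironaka1970AdditiveGroups] [cite: Giraud1975, §1.6 (3), p. 204] -/
theorem exists_eq_adjoin_triangular_of_isDiffStable_fin {n : ℕ} (p : ℕ) [ExpChar K p]
    (U : Subalgebra K (MvPolynomial (Fin n) K)) (hUg : IsGradedSubalgebra U)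
    (hUd : IsDiffStable U) :
    ∃ (r : ℕ) (ι : Fin r → Fin n) (e : Fin r → ℕ) (c : Fin r → Fin n → K),
      r ≤ n ∧ Function.Injective ι ∧ Monotone e ∧
      (∀ j, c j (ι j) = 1) ∧ (∀ j j', j' < j → c j (ι j') = 0) ∧
      AlgebraicIndependent K
        (fun j => (∑ k, C (c j k) * X k ^ p ^ e j : MvPolynomial (Fin n) K)) ∧
      U = Algebra.adjoin K
        (Set.range fun j => (∑ k, C (c j k) * X k ^ p ^ e j : MvPolynomial (Fin n) K)) := by
  obtain ⟨r, ι, e, c, hr, h⟩ := exists_eq_adjoin_triangular_of_isDiffStable p U hUg hUd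
  exact ⟨r, ι, e, c, by simpa using hr, h⟩

/-- **The structure theorem as a characterisation over an arbitrary field**: `U ⊆ K[x]` is graded
and stable under all Hasse–Schmidt derivations iff `U = K[σ_1, …, σ_r]` for algebraically
independent additive forms `σ_j = Σ_k c_{jk} x_k^{p^{e_j}}` in echelon form with respect to
distinct pivots, `e_1 ≤ … ≤ e_r`. [cite: Hironaka1970AdditiveGroups] [cite: Giraud1975, §1.6 (3)] -/
theorem isGradedSubalgebra_and_isDiffStable_iff_triangular (p : ℕ) [ExpChar K p]
    (U : Subalgebra K (MvPolynomial σ K)) :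
    (IsGradedSubalgebra U ∧ IsDiffStable U) ↔
      ∃ (r : ℕ) (ι : Fin r → σ) (e : Fin r → ℕ) (c : Fin r → σ → K),
        r ≤ Fintype.card σ ∧ Function.Injective ι ∧ Monotone e ∧
        (∀ j, c j (ι j) = 1) ∧ (∀ j j', j' < j → c j (ι j') = 0) ∧
        AlgebraicIndependent K
          (fun j => (∑ k, C (c j k) * X k ^ p ^ e j : MvPolynomial σ K)) ∧
        U = Algebra.adjoin K
          (Set.range fun j => (∑ k, C (c j k) * X k ^ p ^ e j : MvPolynomial σ K)) := by
  constructor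
  · rintro ⟨hUg, hUd⟩
    exact exists_eq_adjoin_triangular_of_isDiffStable p U hUg hUd
  · rintro ⟨r, ι, e, c, -, -, -, -, -, -, rfl⟩
    exact ⟨isGradedSubalgebra_adjoin_sum_C_mul_X_pow c _, isDiffStable_adjoin_sum_C_mul_X_pow p c e⟩

end Structure

section Hilbert

/-! ### The Hilbert function of an algebra on algebraically independent homogeneous generators -/

variable {r : ℕ}

omit [Fintype σ] [DecidableEq σ] in
/-- The image of `Y^m` under `Y_j ↦ g_j`, `g_j` homogeneous of degree `q_j`, is homogeneous of
degree `Σ_j m_j q_j`. [folklore] -/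
theorem isHomogeneous_aeval_monomial_of_isHomogeneous (g : Fin r → MvPolynomial σ K)
    (q : Fin r → ℕ) (hg : ∀ j, (g j).IsHomogeneous (q j)) (m : Fin r →₀ ℕ) (a : K) :
    (aeval g (monomial m a)).IsHomogeneous (Finsupp.weight q m) := by
  rw [aeval_monomial, Finsupp.prod_fintype _ _ (fun j => pow_zero _), algebraMap_eq]
  have h : Finsupp.weight q m = 0 + ∑ j, q j * m j := by
    rw [weight_eq_sum, zero_add]
    exact Finset.sum_congr rfl fun j _ => by ring
  rw [h]
  exact (isHomogeneous_C σ a).mul (IsHomogeneous.prod _ _ _ fun j _ => (hg j).pow (m j))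

omit [Fintype σ] [DecidableEq σ] in
/-- **`Y_j ↦ g_j` intertwines the gradings** (`g_j` homogeneous of degree `q_j`): the degree-`a`
component of the image is the image of the weighted-degree-`a` component, weights `q`.
[folklore] -/
theorem homogeneousComponent_aeval_of_isHomogeneous (g : Fin r → MvPolynomial σ K)
    (q : Fin r → ℕ) (hg : ∀ j, (g j).IsHomogeneous (q j)) (a : ℕ) (F : MvPolynomial (Fin r) K) :
    homogeneousComponent a (aeval g F) = aeval g (weightedHomogeneousComponent q a F) := by
  induction F using MvPolynomial.induction_on' with
  | monomial m c =>
    rw [homogeneousComponent_of_mem (isHomogeneous_aeval_monomial_of_isHomogeneous g q hg m c),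
      weightedHomogeneousComponent_of_mem (isWeightedHomogeneous_monomial (R := K) q m c rfl)]
    split_ifs <;> simp
  | add F G hF hG => simp only [map_add, hF, hG]

omit [Fintype σ] [DecidableEq σ] in
/-- The degree-`a` piece of the range of `Y_j ↦ g_j` is the image of the weighted-homogeneous
piece of weighted degree `a`. [folklore] -/
theorem toSubmodule_range_inf_homogeneousSubmodule_of_isHomogeneous (g : Fin r → MvPolynomial σ K)
    (q : Fin r → ℕ) (hg : ∀ j, (g j).IsHomogeneous (q j)) (a : ℕ) :
    Subalgebra.toSubmodule (aeval g).range ⊓ homogeneousSubmodule σ K a =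
      (weightedHomogeneousSubmodule K q a).map
        (aeval g : MvPolynomial (Fin r) K →ₐ[K] MvPolynomial σ K).toLinearMap := by
  ext u
  simp only [Submodule.mem_inf, Subalgebra.mem_toSubmodule, AlgHom.mem_range,
    mem_homogeneousSubmodule, Submodule.mem_map, AlgHom.toLinearMap_apply,
    mem_weightedHomogeneousSubmodule]
  constructor
  · rintro ⟨⟨F, rfl⟩, hu⟩
    refine ⟨weightedHomogeneousComponent q a F,
      weightedHomogeneousComponent_isWeightedHomogeneous a F, ?_⟩
    rw [← homogeneousComponent_aeval_of_isHomogeneous g q hg, homogeneousComponent_of_mem hu,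
      if_pos rfl]
  · rintro ⟨F, hF, rfl⟩
    refine ⟨⟨F, rfl⟩, ?_⟩
    have hF' : F = weightedHomogeneousComponent q a F := by
      rw [weightedHomogeneousComponent_of_mem hF, if_pos rfl]
    rw [hF', ← homogeneousComponent_aeval_of_isHomogeneous g q hg]
    exact homogeneousComponent_isHomogeneous a _

omit [Fintype σ] [DecidableEq σ] in
/-- **Hilbert function of `K[g_1, …, g_r]` for algebraically independent homogeneous `g_j` of
degrees `q_j`**: `dim_K K[g]_a = #{m ∈ ℕ^r : Σ_j m_j q_j = a}`. [folklore] -/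
theorem finrank_adjoin_inf_homogeneousSubmodule_of_isHomogeneous (g : Fin r → MvPolynomial σ K)
    (q : Fin r → ℕ) (hg : ∀ j, (g j).IsHomogeneous (q j)) (hai : AlgebraicIndependent K g)
    (a : ℕ) :
    Module.finrank K
        ↥(Subalgebra.toSubmodule (Algebra.adjoin K (Set.range g)) ⊓ homogeneousSubmodule σ K a) =
      Nat.card {d : Fin r →₀ ℕ // Finsupp.weight q d = a} := by
  have hinj : Function.Injective (aeval (R := K) g) := algebraicIndependent_iff_injective_aeval.mp hai
  rw [Algebra.adjoin_range_eq_range_aeval,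
    toSubmodule_range_inf_homogeneousSubmodule_of_isHomogeneous g q hg a,
    ← finrank_weightedHomogeneousSubmodule (K := K) q a]
  exact (LinearEquiv.finrank_eq (Submodule.equivMapOfInjective _ hinj _)).symm

/-- **The Hilbert function of a graded Hasse–Schmidt-stable subalgebra over an arbitrary field is
that of a polynomial ring with generators in degrees `p^{e_1} ≤ … ≤ p^{e_r}`, `r ≤ #σ`.**
(So the numerical type `(r; p^{e_1}, …, p^{e_r})` — the edge invariant — makes sense without any
perfectness hypothesis.) [cite: Hironaka1970AdditiveGroups] [cite: Giraud1975, §1.6 (3)] -/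
theorem finrank_inf_homogeneousSubmodule_eq_natCard_of_isDiffStable (p : ℕ) [ExpChar K p]
    (U : Subalgebra K (MvPolynomial σ K)) (hUg : IsGradedSubalgebra U) (hUd : IsDiffStable U) :
    ∃ (r : ℕ) (e : Fin r → ℕ), r ≤ Fintype.card σ ∧ Monotone e ∧
      ∀ a, Module.finrank K ↥(Subalgebra.toSubmodule U ⊓ homogeneousSubmodule σ K a) =
        Nat.card {d : Fin r →₀ ℕ // Finsupp.weight (fun j => p ^ e j) d = a} := by
  obtain ⟨r, ι, e, c, hr, -, hemono, -, -, hai, hU⟩ :=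
    exists_eq_adjoin_triangular_of_isDiffStable p U hUg hUd
  refine ⟨r, e, hr, hemono, fun a => ?_⟩
  rw [hU]
  exact finrank_adjoin_inf_homogeneousSubmodule_of_isHomogeneous _ (fun j => p ^ e j)
    (fun j => isHomogeneous_sum_C_mul_X_pow (c j) _) hai a

end Hilbert

end Literature.AlgebraicGeometry.Resolution
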